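import Mathlib
import Summits.ResolutionOfSingularities.ResolutionOfSingularities.Theorems.WildQuotientsWildQuotientResolutionS1PlanarFieldDefs
import Summits.ResolutionOfSingularities.ResolutionOfSingularities.Theorems.WildConesClassicalRegimesStubMuDropCharTwoOrdPLeaves
import Literature.RingTheory.MvPowerSeries.FiniteColength
import Literature.AlgebraicGeometry.Resolution.CobordantArcLemma
import Summits.ResolutionOfSingularities.ResolutionOfSingularities.Theorems.WildQuotientsWildQuotientResolutionS1PlanarFieldTransport

/-!
(FILE 3/3: Part II-b — the SWAP and the reduction principle `forall_isSucc_of_chart1_zero`; decls VERBATIM from res-L1-w45c-idea-1 `w1n/S1W1NTransport.lean` 5281fd5e869a68b1)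

# S1 / W1N cascade — planar-field TRANSPORT TOOLKIT: `IsolatedSucc` (Part I) + brick B3 (Part II)

FILING NOTE.  This file SUPERSEDES `S1W1NIsolatedSucc.lean` (a15dcc7e369fc152) for landing purposes:
Part I below is that file's declarations verbatim; Part II adds brick B3 of the line card
`W1N-LINE.md` (affine transport of `IsSucc`: `shear`, `swapField`, invariance of `milnor` /
`IsIsolated` / `IsSingular` / `IsBadNode` / `linearPart = 0`, and the reduction principle
`forall_isSucc_of_chart1_zero`).  Land ONE of the two, not both (same namespace, same names).

## Part I — support `IsolatedSucc`: successors of an isolated node are isolated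

Crux stmt-ResolutionOfSingularities-17941 (`WildQuotients.CyclicQuotientFourfolds`), S1a line `s1a-logminvertex`,
stub `stub_W1N_print`, sub-line `w1n-cascade` (idea-1 `W1N-LINE.md`): the second of the five supports of
`S1.W1NCascade.W1NPrint_of_cascade`.  [OURS · L1 W4.5c] — NOT a statement of the manuscript; counted 0 post-V5.

THEOREM `PlanarField.isIsolated_of_isSucc`: if `θ = (a, b)` is isolated (`κ⟦x,y⟧/(a,b)` finite over `κ`) and
`θ.IsSucc θ'` (D1: `θ'` is the SATURATED transform of `θ` in chart 1 at some `c`, or in chart 2) then `θ'` is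
isolated.

PROOF (characteristic-free, no Noether).  Chart 1 (`π : x ↦ x, y ↦ x(y + c)`): `𝔪^k ≤ (a, b)` for some `k`
(finite colength), so `x^k = u a + v b`; substituting, `x^k = (u∘π)(a∘π) + (v∘π)(b∘π)` with
`a∘π = x^s a'`, `b∘π = x^{s+1} b' + (y + c) x^s a'` — hence `x^k ∈ (a', b')`.  Saturation says `x ∤ a'` or
`x ∤ b'`; if `x ∤ g` with `g ∈ {a', b'}` then `κ⟦x,y⟧/(x, g)` is finite (its dimension is the `y`-order of
`g(0, y)`: tree `MuDropCharTwoOrdP.colength_X_eq_order`), so `𝔪^M ≤ (x, g)` and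
`𝔪^{M(k+1)} ≤ (x, g)^{k+1} ≤ (x^k) + (g) ≤ (a', b')`: finite colength.  Chart 2 is the same with `x ↔ y`
(transported through the swap automorphism of `κ⟦x,y⟧`).

With the cascade file (`S1.W1NCascade`) in scope,
`theorem isolatedSucc : S1.W1NCascade.IsolatedSucc := fun κ _ θ θ' h₁ h₂ => PlanarField.isIsolated_of_isSucc θ θ' h₁ h₂`.
-/

-- single-problem summit: the doubled namespace component `ResolutionOfSingularities` is forced
set_option linter.dupNamespace false

noncomputable section

open MvPowerSeries IsLocalRing
open Literature.AlgebraicGeometry.Resolution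
open Summit.ResolutionOfSingularities.ResolutionOfSingularities.Theorems.WildCones.MuDropCharTwoOrdP

namespace Summit.ResolutionOfSingularities.ResolutionOfSingularities.Theorems.WildQuotientResolution.S1.PlanarField

variable {κ : Type} [Field κ]
/-! ### The swap `x ↔ y` (paired with `a ↔ b`) -/

/-- `constantCoeff_swapVars` (planar-field transport toolkit; see the module docstring). [OURS · L1 W4.5c] -/
theorem constantCoeff_swapVars : ∀ i, constantCoeff (swapVars κ i) = 0 := by
  intro i; fin_cases i <;> simp [swapVars, constantCoeff_X]

/-- `subst_swapVars_injective` (planar-field transport toolkit; see the module docstring). [OURS · L1 W4.5c] -/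
theorem subst_swapVars_injective : Function.Injective (subst (swapVars κ) : MvPowerSeries (Fin 2) κ → _) :=
  fun f g h => by rw [← subst_swapVars_subst_swapVars f, ← subst_swapVars_subst_swapVars g, h]

/-- The swapped node `(b(y,x), a(y,x))`. [OURS · L1 W4.5c] -/
def swapField (θ : PlanarField κ) : PlanarField κ := ⟨subst (swapVars κ) θ.b, subst (swapVars κ) θ.a⟩

/-- `swapField_a` (planar-field transport toolkit; see the module docstring). [OURS · L1 W4.5c] -/
theorem swapField_a (θ : PlanarField κ) : (swapField θ).a = subst (swapVars κ) θ.b := rfl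

/-- `swapField_b` (planar-field transport toolkit; see the module docstring). [OURS · L1 W4.5c] -/
theorem swapField_b (θ : PlanarField κ) : (swapField θ).b = subst (swapVars κ) θ.a := rfl

/-- `swapField_swapField` (planar-field transport toolkit; see the module docstring). [OURS · L1 W4.5c] -/
theorem swapField_swapField (θ : PlanarField κ) : swapField (swapField θ) = θ := by
  cases θ
  simp [swapField, subst_swapVars_subst_swapVars]

/-- `swap ∘ chart2 = chart1 0 ∘ swap` on series. -/
theorem subst_swapVars_subst_chart2 (f : MvPowerSeries (Fin 2) κ) :
    subst (swapVars κ) (subst (chart2 (κ := κ)) f) = subst (chart1 (0 : κ)) (subst (swapVars κ) f) := by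
  rw [subst_comp_subst_apply (hasSubst_chart2 (κ := κ)) (hasSubst_swapVars (κ := κ)),
    subst_comp_subst_apply (hasSubst_swapVars (κ := κ)) (hasSubst_chart1 (κ := κ) 0)]
  congr 1
  funext s
  fin_cases s
  · show subst (swapVars κ) (X 0 * X 1 : MvPowerSeries (Fin 2) κ) = subst (chart1 (0 : κ)) (X 1 : MvPowerSeries (Fin 2) κ)
    rw [subst_mul (hasSubst_swapVars (κ := κ)), subst_swapVars_X_zero, subst_swapVars_X_one,
      subst_X (R := κ) (hasSubst_chart1 (κ := κ) 0)]
    simp [chart1]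
    ring
  · show subst (swapVars κ) (X 1 : MvPowerSeries (Fin 2) κ) = subst (chart1 (0 : κ)) (X 0 : MvPowerSeries (Fin 2) κ)
    rw [subst_swapVars_X_one, subst_X (R := κ) (hasSubst_chart1 (κ := κ) 0)]
    simp [chart1]

/-- `X_one_dvd_iff_X_zero_dvd_swap` (planar-field transport toolkit; see the module docstring). [OURS · L1 W4.5c] -/
theorem X_one_dvd_iff_X_zero_dvd_swap (f : MvPowerSeries (Fin 2) κ) :
    (X 1 : MvPowerSeries (Fin 2) κ) ∣ f ↔ (X 0 : MvPowerSeries (Fin 2) κ) ∣ subst (swapVars κ) f := by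
  constructor
  · rintro ⟨w, rfl⟩
    exact ⟨subst (swapVars κ) w, by rw [subst_mul (hasSubst_swapVars (κ := κ)), subst_swapVars_X_one]⟩
  · rintro ⟨w, hw⟩
    refine ⟨subst (swapVars κ) w, ?_⟩
    have := congrArg (subst (swapVars κ)) hw
    rwa [subst_swapVars_subst_swapVars, subst_mul (hasSubst_swapVars (κ := κ)), subst_swapVars_X_zero] at this

/-- **B3 (swap).** A chart-2 step from `θ` is a chart-1 step at `0` between the swapped nodes.
[OURS · L1 W4.5c] -/
theorem isSuccChart2_iff_swap (θ θ' : PlanarField κ) :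
    IsSuccChart2 θ θ' ↔ IsSuccChart1 0 (swapField θ) (swapField θ') := by
  have hψ := hasSubst_swapVars (κ := κ)
  unfold IsSuccChart2 IsSuccChart1
  rw [swapField_a, swapField_b, swapField_a, swapField_b, map_zero, add_zero]
  refine exists_congr fun s => ?_
  refine and_congr ?_ (and_congr ?_ ?_)
  · rw [← subst_swapVars_injective.eq_iff, subst_mul hψ, subst_pow hψ, subst_swapVars_X_one,
      subst_swapVars_subst_chart2]
  · rw [← subst_swapVars_injective.eq_iff, subst_mul hψ, subst_pow hψ, subst_swapVars_X_one, subst_sub hψ,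
      subst_mul hψ, subst_swapVars_X_zero, subst_swapVars_subst_chart2, subst_swapVars_subst_chart2]
  · rw [X_one_dvd_iff_X_zero_dvd_swap, X_one_dvd_iff_X_zero_dvd_swap, and_comm]

/-- `span_swapField` (planar-field transport toolkit; see the module docstring). [OURS · L1 W4.5c] -/
theorem span_swapField (θ : PlanarField κ) :
    Ideal.span ({(swapField θ).a, (swapField θ).b} : Set (MvPowerSeries (Fin 2) κ)) =
      (Ideal.span ({θ.a, θ.b} : Set (MvPowerSeries (Fin 2) κ))).map
        (swapEquiv (κ := κ) : MvPowerSeries (Fin 2) κ →+* MvPowerSeries (Fin 2) κ) := by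
  rw [Ideal.map_span, Set.image_pair, RingHom.coe_coe, swapEquiv_apply, swapEquiv_apply, swapField_a,
    swapField_b, Ideal.span_pair_comm]

/-- `quotEquivSwap` (planar-field transport toolkit; see the module docstring). [OURS · L1 W4.5c] -/
def quotEquivSwap (θ : PlanarField κ) :
    (MvPowerSeries (Fin 2) κ ⧸ Ideal.span ({θ.a, θ.b} : Set (MvPowerSeries (Fin 2) κ))) ≃ₐ[κ]
      MvPowerSeries (Fin 2) κ ⧸ Ideal.span ({(swapField θ).a, (swapField θ).b} : Set (MvPowerSeries (Fin 2) κ)) :=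
  Ideal.quotientEquivAlg _ _ (swapEquiv (κ := κ)) (span_swapField θ)

/-- `milnor_swapField` (planar-field transport toolkit; see the module docstring). [OURS · L1 W4.5c] -/
theorem milnor_swapField (θ : PlanarField κ) : (swapField θ).milnor = θ.milnor :=
  ((quotEquivSwap θ).toLinearEquiv.finrank_eq).symm

/-- `isIsolated_swapField_iff` (planar-field transport toolkit; see the module docstring). [OURS · L1 W4.5c] -/
theorem isIsolated_swapField_iff (θ : PlanarField κ) : (swapField θ).IsIsolated ↔ θ.IsIsolated := by
  unfold IsIsolated
  exact ⟨fun h => Module.Finite.equiv (quotEquivSwap θ).symm.toLinearEquiv,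
    fun h => Module.Finite.equiv (quotEquivSwap θ).toLinearEquiv⟩

/-- `isSingular_swapField_iff` (planar-field transport toolkit; see the module docstring). [OURS · L1 W4.5c] -/
theorem isSingular_swapField_iff (θ : PlanarField κ) : (swapField θ).IsSingular ↔ θ.IsSingular := by
  unfold IsSingular
  rw [swapField_a, swapField_b, constantCoeff_subst_of_constantCoeff_zero constantCoeff_swapVars,
    constantCoeff_subst_of_constantCoeff_zero constantCoeff_swapVars, and_comm]

/-- The linear part of the swapped node: both indices flipped (conjugation by the transposition). -/
theorem linearPart_swapField (θ : PlanarField κ) :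
    (swapField θ).linearPart = !![0, 1; 1, 0] * θ.linearPart * !![0, 1; 1, 0] := by
  have hφ := constantCoeff_swapVars (κ := κ)
  have h0 : ∀ j : Fin 2, (swapField θ).linearPart 0 j =
      θ.linearPart 1 0 * (if j = 1 then 1 else 0) + θ.linearPart 1 1 * (if j = 0 then 1 else 0) := by
    intro j
    rw [linearPart_apply_zero, swapField_a, coeff_one_subst hφ, swapVars_zero, swapVars_one, coeff_one_X_zero,
      coeff_one_X_one, linearPart_apply_one, linearPart_apply_one]
  have h1 : ∀ j : Fin 2, (swapField θ).linearPart 1 j =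
      θ.linearPart 0 0 * (if j = 1 then 1 else 0) + θ.linearPart 0 1 * (if j = 0 then 1 else 0) := by
    intro j
    rw [linearPart_apply_one, swapField_b, coeff_one_subst hφ, swapVars_zero, swapVars_one, coeff_one_X_zero,
      coeff_one_X_one, linearPart_apply_zero, linearPart_apply_zero]
  ext i j
  simp only [Matrix.mul_apply, Fin.sum_univ_two]
  fin_cases i <;> fin_cases j <;> simp [h0, h1]

/-- `trace_linearPart_swapField` (planar-field transport toolkit; see the module docstring). [OURS · L1 W4.5c] -/
theorem trace_linearPart_swapField (θ : PlanarField κ) :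
    (swapField θ).linearPart.trace = θ.linearPart.trace := by
  have hSS : (!![0, 1; 1, 0] : Matrix (Fin 2) (Fin 2) κ) * !![0, 1; 1, 0] = 1 := by
    ext i j; fin_cases i <;> fin_cases j <;> simp [Matrix.mul_apply, Fin.sum_univ_two]
  rw [linearPart_swapField, Matrix.trace_mul_cycle, hSS, Matrix.one_mul]

/-- `det_linearPart_swapField` (planar-field transport toolkit; see the module docstring). [OURS · L1 W4.5c] -/
theorem det_linearPart_swapField (θ : PlanarField κ) :
    (swapField θ).linearPart.det = θ.linearPart.det := by
  rw [linearPart_swapField, Matrix.det_mul, Matrix.det_mul, Matrix.det_fin_two_of]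
  ring

/-- `isNilpotent_linearPart_swapField_iff` (planar-field transport toolkit; see the module docstring). [OURS · L1 W4.5c] -/
theorem isNilpotent_linearPart_swapField_iff (θ : PlanarField κ) :
    IsNilpotent (swapField θ).linearPart ↔ IsNilpotent θ.linearPart := by
  rw [isNilpotent_iff_trace_det, isNilpotent_iff_trace_det, trace_linearPart_swapField,
    det_linearPart_swapField]

/-- `isBadNode_swapField_iff` (planar-field transport toolkit; see the module docstring). [OURS · L1 W4.5c] -/
theorem isBadNode_swapField_iff (θ : PlanarField κ) : (swapField θ).IsBadNode ↔ θ.IsBadNode := by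
  unfold IsBadNode
  rw [isSingular_swapField_iff, isNilpotent_linearPart_swapField_iff]

/-- `linearPart_swapField_eq_zero_iff` (planar-field transport toolkit; see the module docstring). [OURS · L1 W4.5c] -/
theorem linearPart_swapField_eq_zero_iff (θ : PlanarField κ) :
    (swapField θ).linearPart = 0 ↔ θ.linearPart = 0 := by
  have hSS : (!![0, 1; 1, 0] : Matrix (Fin 2) (Fin 2) κ) * !![0, 1; 1, 0] = 1 := by
    ext i j; fin_cases i <;> fin_cases j <;> simp [Matrix.mul_apply, Fin.sum_univ_two]
  rw [linearPart_swapField]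
  constructor
  · intro h
    have h' := congrArg (fun M => (!![0, 1; 1, 0] : Matrix (Fin 2) (Fin 2) κ) * M * !![0, 1; 1, 0]) h
    simp only [Matrix.mul_zero, Matrix.zero_mul] at h'
    rw [← h']
    rw [← Matrix.mul_assoc, ← Matrix.mul_assoc, hSS, Matrix.one_mul, Matrix.mul_assoc, hSS, Matrix.mul_one]
  · intro h
    rw [h, Matrix.mul_zero, Matrix.zero_mul]

/-! ### The reduction principle -/

/-- **B3 (reduction to chart 1 at `c = 0`).**  A property of successor pairs that pulls back along
`shear c` (same successor) and along `swapField` (both nodes) and holds for chart-1 steps at `0` holds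
for every successor. [OURS · L1 W4.5c] -/
theorem forall_isSucc_of_chart1_zero {P : PlanarField κ → PlanarField κ → Prop}
    (hshear : ∀ (c : κ) (θ θ' : PlanarField κ), P (shear c θ) θ' → P θ θ')
    (hswap : ∀ θ θ' : PlanarField κ, P (swapField θ) (swapField θ') → P θ θ')
    (h0 : ∀ θ θ' : PlanarField κ, IsSuccChart1 0 θ θ' → P θ θ') :
    ∀ θ θ' : PlanarField κ, θ.IsSucc θ' → P θ θ' := by
  intro θ θ' h
  rcases h with ⟨c, hc⟩ | h2
  · exact hshear c θ θ' (h0 _ _ ((isSuccChart1_iff_shear c θ θ').1 hc))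
  · exact hswap θ θ' (h0 _ _ ((isSuccChart2_iff_swap θ θ').1 h2))

end Summit.ResolutionOfSingularities.ResolutionOfSingularities.Theorems.WildQuotientResolution.S1.PlanarField

end
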